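import Summits.AnomalousDissipation.AnomalousDissipation.Theorems.BaireTransferRobustLoudUpgradeLine
import Literature.Analysis.FluidPDE.SteadyNSLatticePersistence
import Literature.Analysis.FluidPDE.EulerReynolds
import Literature.Analysis.FunctionSpaces.TorusFourierConvolution

/-!
# Stub `stub_segmentSteady` of the line `malkin-cone-group-orbits` (crux stmt-AnomalousDissipation-1144, lead c14):
# the designer segment `t ↦ (t•u₀, t²c + (t²−t)ν e)` consists of exact steady states

Registered signature (proved here, textually):
`theorem stub_segmentSteady : ∀ (S : Finset (Fin 3 → ℤ)) (c e : Coeff S) (ν : ℝ) (u₀ : UnitAddTorus (Fin 3) →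
EuclideanSpace ℝ (Fin 3)) (p₀ : UnitAddTorus (Fin 3) → ℝ) (t : ℝ), Torus.IsSteadyNSState ν (force S c) u₀ p₀ →
(∀ x, laplacian u₀ x = force S e x) → Torus.IsSteadyNSState ν (force S (t ^ 2 • c + ((t ^ 2 - t) * ν) • e))
(fun x => t • u₀ x) (fun x => t ^ 2 * p₀ x)`.

If `u₀` is a classical steady state of `NS_ν(f_c)` with pressure `p₀` whose Laplacian is itself a force of the
family, `Δu₀ = f_e`, then for every real `t` the rescaled field `t•u₀` with pressure `t²p₀` is a classical steady
state of `NS_ν` (SAME viscosity) forced by `f_{t²c + (t²−t)ν e}`: indeed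
`(t u₀·∇)(t u₀) − νΔ(t u₀) + ∇(t²p₀) = t²((u₀·∇)u₀ + ∇p₀) − tνΔu₀ = t²(f_c + νΔu₀) − tνΔu₀ = t² f_c + (t² − t)ν f_e`,
and `c ↦ f_c` is real-linear (`SteadyLattice.projForce_add`, `SteadyLattice.projForce_smul`).  The pointwise
calculus is that of the parabolic rescaling `DenseLoudDesignerForces/Negative/Scaling.lean` (`Torus.fderiv_const_smul`,
`Torus.gradient_const_smul`, `Torus.laplacian_const_smul_apply`, `Torus.divergence_const_smul`).  Pure proof file
(no definitions).
-/

-- `Summit.<Summit>.<Problem>` is the tree's mandated summit-side namespace (CONVENTIONS §2); for this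
-- single-conjunct summit the two coincide, so the duplicate is deliberate.
set_option linter.dupNamespace false

noncomputable section

open scoped BigOperators Topology
open Filter Set Function TopologicalSpace MeasureTheory

namespace Summit.AnomalousDissipation.AnomalousDissipation.Theorems.RobustLoudUpgrade.Poly.SegmentSteady

open Literature.Analysis.FunctionSpaces Literature.Analysis.FunctionSpaces.Torus
open Literature.Analysis.FluidPDE
open Summit.AnomalousDissipation.AnomalousDissipation.Theses.BaireTransfer

/-- The designer force is real-linear in the coefficient vector: `f_{a c + b e} = a f_c + b f_e`
(`SteadyLattice.projForce_add` / `projForce_smul`; `force` unfolds to their left-hand sides). [folklore] -/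
theorem force_add_smul (S : Finset (Fin 3 → ℤ)) (a b : ℝ) (c e : Coeff S) :
    force S (a • c + b • e) = a • force S c + b • force S e := by
  unfold force
  rw [SteadyLattice.projForce_add, SteadyLattice.projForce_smul, SteadyLattice.projForce_smul]

/-- A time-constant field has zero (one-sided) time derivative. [folklore] -/
theorem timeDerivWithin_const_field {F : Type*} [NormedAddCommGroup F] [NormedSpace ℝ F]
    (v : UnitAddTorus (Fin 3) → F) (s : ℝ) (x : UnitAddTorus (Fin 3)) :
    Torus.timeDerivWithin Set.univ (fun _ : ℝ => v) s x = 0 := by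
  simp [Torus.timeDerivWithin]

/-- **The registered stub `stub_segmentSteady`** (the designer segment is a segment of EXACT steady states at the
same viscosity): if `u₀` is a classical steady state of `NS_ν(f_c)` with pressure `p₀` and `Δu₀ = f_e`, then `t•u₀`
is a classical steady state of `NS_ν(f_{t²c + (t²−t)ν e})` with pressure `t²p₀`. [folklore] -/
theorem stub_segmentSteady :
    ∀ (S : Finset (Fin 3 → ℤ)) (c e : Coeff S) (ν : ℝ) (u₀ : UnitAddTorus (Fin 3) → EuclideanSpace ℝ (Fin 3))
      (p₀ : UnitAddTorus (Fin 3) → ℝ) (t : ℝ), Torus.IsSteadyNSState ν (force S c) u₀ p₀ →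
      (∀ x, laplacian u₀ x = force S e x) →
      Torus.IsSteadyNSState ν (force S (t ^ 2 • c + ((t ^ 2 - t) * ν) • e)) (fun x => t • u₀ x) (fun x => t ^ 2 * p₀ x) := by
  intro S c e ν u₀ p₀ t hst he
  have hu : IsSmooth u₀ := hst.smooth_velocity.isSmooth_slice (Set.mem_univ 0)
  have hp : IsSmooth p₀ := hst.smooth_pressure.isSmooth_slice (Set.mem_univ 0)
  refine ⟨hst.smooth_velocity.const_smul t, ?_, fun s _ x => ?_, fun s _ x => ?_⟩
  · -- joint smoothness of the rescaled pressure
    simpa only [smul_eq_mul] using hst.smooth_pressure.const_smul (t ^ 2)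
  · -- the momentum equation along the segment
    have h2 : Torus.convect (fun y => t • u₀ y) (fun y => t • u₀ y) x = t ^ 2 • Torus.convect u₀ u₀ x := by
      change Torus.fderiv (t • u₀) x (t • u₀ x) = _
      rw [Torus.fderiv_const_smul (hu.isContDiff (by simp)), FunLike.coe_smul, Pi.smul_apply, map_smul, smul_smul,
        ← pow_two]
      rfl
    have h3 : Torus.gradient (fun y => t ^ 2 * p₀ y) x = t ^ 2 • Torus.gradient p₀ x := by
      change Torus.gradient (t ^ 2 • p₀) x = _
      exact Torus.gradient_const_smul (hp.isContDiff (by simp)) _ _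
    have h4 : Torus.laplacian (fun y => t • u₀ y) x = t • Torus.laplacian u₀ x := by
      change Torus.laplacian (t • u₀) x = _
      exact Torus.laplacian_const_smul_apply hu t x
    have hm := hst.momentum s (Set.mem_univ s) x
    rw [timeDerivWithin_const_field, zero_add, he x] at hm
    rw [timeDerivWithin_const_field, zero_add, h2, h3, h4, force_add_smul, Pi.add_apply, Pi.smul_apply,
      Pi.smul_apply, he x]
    linear_combination (norm := module) t ^ 2 • hm
  · -- incompressibility along the segment
    change Torus.divergence (t • u₀) x = 0
    rw [Torus.divergence_const_smul (hu.isContDiff (by simp)), hst.divFree 0 (Set.mem_univ 0) x, mul_zero]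

end Summit.AnomalousDissipation.AnomalousDissipation.Theorems.RobustLoudUpgrade.Poly.SegmentSteady

end
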